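import Summits.AnomalousDissipation.AnomalousDissipation.Theorems.SolenoidalFractalHomogenisationLagrangianStepFrameConjugacyInputs
import Summits.AnomalousDissipation.AnomalousDissipation.Theorems.SolenoidalFractalHomogenisationLagrangianStepEulerianSubwindowRepr
import HarnessLib

/-!
# K1L_D (stmt-AnomalousDissipation-27980), `stub_Z7_alphaBeta` α-provider: the Eulerian representation input discharged —
# `FrameConjugacyAt` on a closed piece FROM THE MODULATION DATUM ALONE (helper; `--supports … --as helper`; lead-k1l-onelevel-p1 g5)

`frameConjugacyAt_of_inputs` (p705630) took two inputs: the modulation datum (hmod) and the Eulerian representation property of the window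
propagators on sub-windows (hErepr × 2).  The latter is `FrameConj.eulerian_subwindow_repr` (p698742) along any partial sum `b_{≤n}`
(continuous and bounded — `LevelRegular` (L1)/(L3) —, weakly solenoidal) with any elliptic tensor: **`hErepr_partialSum`**.  Hence
**`frameConjugacyAt_of_modulation`**: `FrameConjugacyAt W M hM gain Φ Cα ϱ E m S Um1 Um (jR) t` from (hmod) plus the ellipticity of the two
Eulerian tensors (`NearIso (kbar (m+1) • S) lo₁ hi₁`, `NearIso (kbar m • renormStep …) lo₀ hi₀`, `0 < lo₁, lo₀` — available in the glue from
`NearIso S lo hi`, `NearIso (Φ ν S) lo hi`).  What remains of the α-part of `stub_Z7_alphaBeta` is (hmod) = p3's `isModulation_frameG` at the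
closed endpoint + K8-5 `hcurv`.  NOT a proof of the stub, of the crux, or of AD; rung F-D1.A0.
-/

set_option linter.dupNamespace false  -- the summit-side namespace `Summit.AnomalousDissipation.AnomalousDissipation.…` repeats a component by design (D-0017)

noncomputable section

namespace Summit.AnomalousDissipation.AnomalousDissipation.Theorems.SolenoidalFractalHomogenisation.LagrangianStep.FrameConj

open Set Function Filter MeasureTheory Topology
open scoped NNReal ENNReal
open Literature.Analysis Literature.Analysis.FunctionSpaces Literature.Analysis.FunctionSpaces.Torus
open Literature.Analysis.FluidPDE Literature.Analysis.FluidPDE.LatticeShear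
open Literature.Analysis.FluidPDE.LatticeShear (LagrangianLatticeCarrier LatticeWord)
open Summit.AnomalousDissipation.AnomalousDissipation.Theorems.SolenoidalFractalHomogenisation.LagrangianStep.CellClauseMod
open Summit.AnomalousDissipation.AnomalousDissipation.Theorems.SolenoidalFractalHomogenisation.LagrangianStep.Z7Glue

variable {k : ℕ}

/-- The space–time lift of a partial sum is in `L^∞` on every time slab (continuity (L1) and the order-0 bound of (L3)). -/
theorem memLp_top_stLift_partialSum (E : LagrangianLatticeCarrier k) (hR : E.LevelRegular) (n : ℕ) (S : Set ℝ) :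
    MemLp (stLift (E.partialSum n)) ∞ (volume.restrict (S ×ˢ (univ : Set (EuclideanSpace ℝ (Fin 3))))) := by
  obtain ⟨C, hC⟩ := exists_norm_partialSum_le E hR n
  have hcont : Continuous (stLift (E.partialSum n)) := by
    have e : stLift (E.partialSum n) = uncurry (E.partialSum n) ∘ Prod.map id proj := by funext p; rfl
    rw [e]
    exact (hR.continuous_uncurry_partialSum n).comp (continuous_id.prodMap continuous_proj)
  exact memLp_top_of_bound hcont.aestronglyMeasurable C (Filter.Eventually.of_forall fun p => hC p.1 (proj p.2))

/-- **The Eulerian representation input (hErepr) along a partial sum**: flat weak solutions on sub-windows `[t₁, t] ⊆ [s, t] ⊆ [0,1]` are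
represented by the propagator (`FrameConj.eulerian_subwindow_repr`). -/
theorem hErepr_partialSum (E : LagrangianLatticeCarrier k) (hR : E.LevelRegular) (n : ℕ) {𝔸 : Torus.Visc4 (Fin 3)} {lo hi : ℝ}
    (h𝔸 : Torus.NearIso 𝔸 lo hi) (hlo : 0 < lo) {U : ℝ → ℝ → (V2 →L[ℝ] V2)} (hU : Torus.IsPropagator 1 (E.partialSum n) 𝔸 U)
    {s t : ℝ} (hs0 : 0 ≤ s) (ht1 : t ≤ 1) :
    ∀ t₁ : ℝ, s ≤ t₁ → t₁ < t → ∀ (φE : VF) (hφE : MemLp φE 2 volume), Torus.IsWeaklyDivFree φE → ∀ u : ℝ → VF,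
      Torus.IsWeakTensorPassiveVectorOn 0 (t - t₁) 𝔸 (fun τ' => E.partialSum n (t₁ + τ')) φE u →
      ∀ᵐ τ' ∂(volume.restrict (Ioo 0 (t - t₁))), ∃ hτ : MemLp (u τ') 2 volume, hτ.toLp (u τ') = U t₁ (t₁ + τ') (hφE.toLp φE) :=
  fun _ hst₁ ht₁t _ hφE hφEdiv _ hu =>
    eulerian_subwindow_repr hU h𝔸 hlo (memLp_top_stLift_partialSum E hR n (Ioo 0 1))
      (Filter.Eventually.of_forall fun t' => isWeaklyDivFree_partialSum E hR n t') (hs0.trans hst₁) ht₁t ht1 hφE hφEdiv hu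

/-- **`FrameConjugacyAt` on a closed piece from the modulation datum** (and the ellipticity of the two Eulerian tensors).  The only remaining
input of the α-part of `stub_Z7_alphaBeta` is `hmod`. -/
theorem frameConjugacyAt_of_modulation (E : LagrangianLatticeCarrier k) (hL : E.LPermissible) (hR : E.LevelRegular) {W : LatticeWord k}
    {M : ℝ} {hM : 0 < M} (hdes : E.design = W.stretch M hM) (Φ : ℝ → Torus.Visc4 (Fin 3) → Torus.Visc4 (Fin 3))
    {Cα ϱ θ : ℝ} (m j : ℕ) (S : Torus.Visc4 (Fin 3)) {t : ℝ}
    (hj0 : 0 ≤ (j : ℝ) * E.refresh (m + 1)) (hjt : (j : ℝ) * E.refresh (m + 1) < t)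
    (htR : t ≤ (j : ℝ) * E.refresh (m + 1) + E.refresh (m + 1)) (ht1 : t ≤ 1)
    (hν : 0 < E.cellVisc (m + 1)) (hθ0 : 0 ≤ θ) (hθ : θ ≤ Cα * E.θ (m + 1)) (hϱ : 0 ≤ ϱ)
    (hmod : IsModulation θ (E.a (m + 1) * (t - (j : ℝ) * E.refresh (m + 1))) (ϱ * E.N m)
      (fun τ y => frameG E m ((j : ℝ) * E.refresh (m + 1) + τ / E.a (m + 1)) ((j : ℝ) * E.refresh (m + 1)) y))
    {Um Um1 : ℝ → ℝ → (V2 →L[ℝ] V2)}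
    (hU1 : Torus.IsPropagator 1 (E.partialSum (m + 1)) (E.kbar (m + 1) • S) Um1)
    (hU : Torus.IsPropagator 1 (E.partialSum m) (E.kbar m • renormStep (Φ (E.cellVisc (m + 1))) (E.gain / E.cellVisc (m + 1) ^ 2) S) Um)
    {lo₁ hi₁ lo₀ hi₀ : ℝ} (h𝔸1 : Torus.NearIso (E.kbar (m + 1) • S) lo₁ hi₁) (hlo₁ : 0 < lo₁)
    (h𝔸0 : Torus.NearIso (E.kbar m • renormStep (Φ (E.cellVisc (m + 1))) (E.gain / E.cellVisc (m + 1) ^ 2) S) lo₀ hi₀) (hlo₀ : 0 < lo₀) :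
    FrameConjugacyAt W M hM E.gain Φ Cα ϱ E m S Um1 Um ((j : ℝ) * E.refresh (m + 1)) t :=
  frameConjugacyAt_of_inputs E hL hR hdes Φ m j S hj0 hjt htR ht1 hν hθ0 hθ hϱ hmod hU1 hU
    (hErepr_partialSum E hR (m + 1) h𝔸1 hlo₁ hU1 hj0 ht1) (hErepr_partialSum E hR m h𝔸0 hlo₀ hU hj0 ht1)

end Summit.AnomalousDissipation.AnomalousDissipation.Theorems.SolenoidalFractalHomogenisation.LagrangianStep.FrameConj

end
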